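import Literature.NumberTheory.Automorphic.MirabolicTowerGroups
import Literature.NumberTheory.Automorphic.UnipotentTateDomain
import Literature.NumberTheory.Automorphic.UnipotentCosetTower
import HarnessLib

/-!
# Reduction of the corner of a unipotent adelic matrix modulo `N_m(K)` (Tate's box), and the rows of
# the reduced rational representative

Topic `NumberTheory/Automorphic`; namespace `Literature.NumberTheory.Automorphic`. Pure matrix algebra
over the adeles, for the absolute convergence of the Fourier–Whittaker expansion of cusp forms on
`GL_n` (Cogdell (2004), Thm. 1.1: the sum over `N_{n-1}(K) \ GL_{n-1}(K)` is estimated by choosing in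
every coset a representative adapted to the Iwasawa decomposition of `diag(γ, 1) x`). With
`n = m + 1`, `u ∈ N_n(𝔸_K)` and `γ₀ ∈ GL_m(K)`:

* `cornerize_mul_eq_of_mem_cornerGL` — the corner map `g ↦ diag(g|_{d×d}, 1)` (`cornerize` of
  `MirabolicTower`) is multiplicative against corners: `corner(g D) = corner(g) D` for `D ∈ GL_d`;
  `map_cornerize` — it commutes with ring homomorphisms.
* `exists_upperUnitriangular_rows_eq` — **the reduction**: there are `ν ∈ N_m(K)` and adeles
  `ω i l` in Tate's additive fundamental domain `D = D_∞ × ∏_v 𝒪_v` (`adeleFundamentalDomain`, with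
  `ω i i = 1`) such that for every row index `i < m` the row `i` of the rational matrix
  `diag((ν γ₀)_𝔸, 1)` is `∑_{l<m} ω i l · (row l of u⁻¹ diag(γ₀,1) with its last entry removed)`.
  Proof: `C' = corner(u⁻¹) ∈ N_n(𝔸_K)`; Tate's decomposition `N_n(𝔸_K) = N_n(K) · 𝓕_N`
  (`existsUnique_smul_mem_unipotentTateDomain`, applied to `C'⁻¹`) gives `γ_N ∈ N_n(K)` and
  `ω₀ ∈ 𝓕_N` with `γ_N = ω₀ C'`; then `corner(γ_N) = corner(ω₀) C'` is the adelic image of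
  `diag(ν, 1)`, `ν ∈ N_m(K)`, and `diag(ν γ₀, 1) = corner(ω₀) · corner(u⁻¹ diag(γ₀, 1))`.

In the application the rows of `u⁻¹ diag(γ₀, 1) x = a k` (Iwasawa) have controlled size, whence the
rows of `diag(ν γ₀, 1) x` do. Everything here is proved; no definitions are introduced.

## References

* J. W. Cogdell, *Analytic theory of L-functions for GL_n*, in *An Introduction to the Langlands
  Program* (2004), §1.1, Thm. 1.1 [CogdellAnalyticTheory2004].
* J. Tate, in Cassels–Fröhlich (1967), Ch. XV, §4.1, Thm. 4.1.3 [CasselsFrohlichANT1967].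
-/

noncomputable section

open NumberField IsDedekindDomain Matrix Set
open scoped MatrixGroups

namespace Literature.NumberTheory.Automorphic

/-! ### The corner map is multiplicative against corners and commutes with ring homomorphisms -/

section Corner

variable {n : ℕ} {R : Type*} [CommRing R]

/-- **`corner(g D) = corner(g) · D` for `D ∈ GL_d`** (`g ∈ Q_e`, `e ≤ d`): the corner block of `g D` is
the corner block of `g` times that of `D`, because the rows `≥ d` of `D` are those of the identity.
[folklore] -/
theorem cornerize_mul_eq_of_mem_cornerGL {e d : ℕ} (hed : e ≤ d) {g D : GL (Fin n) R}
    (hg : g ∈ tailUnipotent n R e) (hD : D ∈ cornerGL n R d) (hgD : g * D ∈ tailUnipotent n R d) :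
    cornerize d le_rfl (g * D) hgD = cornerize d hed g hg * D := by
  refine Units.ext (Matrix.ext fun i j => ?_)
  rw [coe_cornerize, Units.val_mul, coe_cornerize, cornerMatrix_apply, Matrix.mul_apply]
  by_cases hij : (i : ℕ) < d ∧ (j : ℕ) < d
  · rw [if_pos hij, Units.val_mul, Matrix.mul_apply]
    refine Finset.sum_congr rfl fun l _ => ?_
    rw [cornerMatrix_apply]
    by_cases hl : (l : ℕ) < d
    · rw [if_pos ⟨hij.1, hl⟩]
    · have hDl : (D : Matrix (Fin n) (Fin n) R) l j = 0 := by
        rw [hD l j (Or.inl (not_lt.1 hl)), if_neg]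
        intro h; rw [h] at hl; exact hl hij.2
      rw [hDl, mul_zero, mul_zero]
  · rw [if_neg hij]
    by_cases hi : (i : ℕ) < d
    · have hj : d ≤ (j : ℕ) := not_lt.1 fun h => hij ⟨hi, h⟩
      have hDj : ∀ l, (D : Matrix (Fin n) (Fin n) R) l j = if l = j then 1 else 0 := fun l => hD l j (Or.inr hj)
      rw [Finset.sum_eq_single j]
      · rw [hDj j, if_pos rfl, mul_one, cornerMatrix_apply, if_neg hij]
      · intro l _ hl; rw [hDj l, if_neg hl, mul_zero]
      · intro h; exact absurd (Finset.mem_univ j) h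
    · have hcm : ∀ l, cornerMatrix d g i l = if i = l then 1 else 0 := fun l => by
        rw [cornerMatrix_apply, if_neg (fun h => hi h.1)]
      simp only [hcm, ite_mul, one_mul, zero_mul, Finset.sum_ite_eq, Finset.mem_univ, if_true]
      exact (hD i j (Or.inl (not_lt.1 hi))).symm

/-- **The corner map commutes with ring homomorphisms.** [folklore] -/
theorem map_cornerize {S : Type*} [CommRing S] (f : R →+* S) {e : ℕ} (d : ℕ) (hed : e ≤ d)
    (g : GL (Fin n) R) (hg : g ∈ tailUnipotent n R e) (hg' : Matrix.GeneralLinearGroup.map f g ∈ tailUnipotent n S e) :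
    Matrix.GeneralLinearGroup.map f (cornerize d hed g hg) = cornerize d hed (Matrix.GeneralLinearGroup.map f g) hg' := by
  refine Units.ext (Matrix.ext fun i j => ?_)
  rw [Matrix.GeneralLinearGroup.map_apply, coe_cornerize, coe_cornerize, cornerMatrix_apply, cornerMatrix_apply,
    Matrix.GeneralLinearGroup.map_apply]
  split_ifs <;> simp

/-- Membership in `Q_e` is preserved by ring homomorphisms (private copy of `map_mem_tailUnipotent` of
`WhittakerTower`, not imported here). [folklore] -/
private theorem map_mem_tailUnipotent' {S : Type*} [CommRing S] (f : R →+* S) {e : ℕ} {g : GL (Fin n) R}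
    (hg : g ∈ tailUnipotent n R e) : Matrix.GeneralLinearGroup.map f g ∈ tailUnipotent n S e := by
  intro i j hi hji
  rw [Matrix.GeneralLinearGroup.map_apply, hg i j hi hji]
  split_ifs <;> simp

/-- The entries of the corner in the rows `< d`: the entries of `g` in the columns `< d`, and `0` in
the columns `≥ d`. [folklore] -/
theorem cornerize_apply_of_lt {e : ℕ} (d : ℕ) (hed : e ≤ d) (g : GL (Fin n) R) (hg : g ∈ tailUnipotent n R e)
    {i : Fin n} (hi : (i : ℕ) < d) (j : Fin n) :
    ((cornerize d hed g hg : GL (Fin n) R) : Matrix (Fin n) (Fin n) R) i j =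
      if (j : ℕ) < d then (g : Matrix (Fin n) (Fin n) R) i j else 0 := by
  rw [coe_cornerize, cornerMatrix_apply]
  by_cases hj : (j : ℕ) < d
  · rw [if_pos ⟨hi, hj⟩, if_pos hj]
  · rw [if_neg (fun h => hj h.2), if_neg hj, if_neg]
    intro h; rw [h] at hi; exact hj hi

end Corner

/-! ### Rational corners -/

section Rational

variable {m : ℕ} {K : Type} [Field K]

/-- **A rational upper unitriangular matrix in corner form is `diag(ν, 1)` with `ν ∈ N_m(K)`**
(`exists_glCorner_eq_of_cornerForm` and `glCorner_mem_upperUnitriangular_iff`). [folklore] -/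
theorem exists_glCorner_eq_of_mem_cornerGL_of_mem_upperUnitriangular {δ : GL (Fin (m + 1)) K}
    (hδ : δ ∈ cornerGL (m + 1) K m) (hδu : δ ∈ upperUnitriangular (Fin (m + 1)) K) :
    ∃ ν : GL (Fin m) K, ν ∈ upperUnitriangular (Fin m) K ∧ glCorner K (Nat.le_succ m) ν = δ := by
  obtain ⟨ν, hν⟩ := exists_glCorner_eq_of_cornerForm (Nat.le_succ m) δ fun i j hij =>
    hδ i j (by rcases not_and_or.1 hij with h | h <;> [exact Or.inl (not_lt.1 h); exact Or.inr (not_lt.1 h)])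
  refine ⟨ν, ?_, hν⟩
  rw [← glCorner_mem_upperUnitriangular_iff, hν]
  exact hδu

end Rational

/-! ### The reduction -/

section Reduction

variable {m : ℕ} {K : Type} [Field K] [NumberField K]

/-- `N_{m+1} ≤ Q_0 = N_{m+1}` (`tailUnipotent_zero`). [folklore] -/
private theorem mem_tailUnipotent_zero_of_mem {u : GL (Fin (m + 1)) (AdeleRing (𝓞 K) K)}
    (hu : u ∈ adelicUnipotent (m + 1) K) : u ∈ tailUnipotent (m + 1) (AdeleRing (𝓞 K) K) 0 := by
  rw [tailUnipotent_zero]; exact hu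

/-- **Reduction of the corner modulo `N_m(K)`** (the choice of representatives in the proof of the
absolute convergence of the Fourier expansion, Cogdell (2004), Thm. 1.1, through Tate's
`N_n(𝔸_K) = N_n(K) · 𝓕_N`). Let `n = m + 1`, `u ∈ N_n(𝔸_K)`, `γ₀ ∈ GL_m(K)`, and put
`P = u⁻¹ · diag(γ₀, 1)`. There are `ν ∈ N_m(K)` and adeles `ω i l ∈ D ∪ {1}` (Tate's additive
fundamental domain `adeleFundamentalDomain K`: finite-integral, archimedean part in the fundamental
parallelotope of `𝓞_K`) such that for all `i, j` with `i < m`: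
`(diag((ν γ₀)_𝔸, 1))_{ij} = ∑_{l<m} ω i l · P'_{lj}`, where `P'` is `P` with its last column replaced by
`0`. [cite: CogdellAnalyticTheory2004, Thm. 1.1] -/
theorem exists_upperUnitriangular_glCorner_apply_eq (u : GL (Fin (m + 1)) (AdeleRing (𝓞 K) K))
    (hu : u ∈ adelicUnipotent (m + 1) K) (γ₀ : GL (Fin m) K) :
    ∃ (ν : GL (Fin m) K) (ω : Fin (m + 1) → Fin (m + 1) → AdeleRing (𝓞 K) K),
      ν ∈ upperUnitriangular (Fin m) K ∧
      (∀ i l, ω i l ∈ adeleFundamentalDomain K ∨ ω i l = 1) ∧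
      ∀ i j : Fin (m + 1), (i : ℕ) < m →
        ((glCorner (AdeleRing (𝓞 K) K) (Nat.le_succ m) (ratGL K (ν * γ₀)) : GL (Fin (m + 1)) (AdeleRing (𝓞 K) K)) :
            Matrix (Fin (m + 1)) (Fin (m + 1)) (AdeleRing (𝓞 K) K)) i j =
          ∑ l : Fin (m + 1), if (l : ℕ) < m then
            ω i l * (if (j : ℕ) < m then ((u⁻¹ * glCorner (AdeleRing (𝓞 K) K) (Nat.le_succ m) (ratGL K γ₀) :
              GL (Fin (m + 1)) (AdeleRing (𝓞 K) K)) : Matrix (Fin (m + 1)) (Fin (m + 1)) (AdeleRing (𝓞 K) K)) l j else 0)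
          else 0 := by
  -- notation
  set A := AdeleRing (𝓞 K) K with hA
  set γt : GL (Fin (m + 1)) A := glCorner A (Nat.le_succ m) (ratGL K γ₀) with hγt
  have hγt_corner : γt ∈ cornerGL (m + 1) A m := glCorner_mem_cornerGL _ _
  have hu' : u⁻¹ ∈ adelicUnipotent (m + 1) K := inv_mem hu
  have hu'0 : u⁻¹ ∈ tailUnipotent (m + 1) A 0 := mem_tailUnipotent_zero_of_mem hu'
  -- the corner `C'` of `u⁻¹`, a unitriangular corner
  set C' : GL (Fin (m + 1)) A := cornerize m (Nat.zero_le m) u⁻¹ hu'0 with hC'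
  have hC'u : C' ∈ adelicUnipotent (m + 1) K := by
    have h := cornerize_mem_tailUnipotent m (Nat.zero_le m) u⁻¹ hu'0
    rwa [tailUnipotent_zero] at h
  have hC'c : C' ∈ cornerGL (m + 1) A m := cornerize_mem_cornerGL m (Nat.zero_le m) u⁻¹ hu'0
  -- Tate: `γ_N = ω₀ C'` with `ω₀` in the Tate domain
  obtain ⟨γN, hγN, -⟩ := existsUnique_smul_mem_unipotentTateDomain (n := m + 1) (K := K) ⟨C'⁻¹, inv_mem hC'u⟩
  set ω₀ : ↥(adelicUnipotent (m + 1) K) := γN • ⟨C'⁻¹, inv_mem hC'u⟩ with hω₀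
  have hω₀T : ω₀ ∈ unipotentTateDomain (m + 1) K := hγN
  obtain ⟨γK, hγK⟩ := (mem_rationalUnipotent_iff _).1 γN.2
  have hγKu : γK ∈ upperUnitriangular (Fin (m + 1)) K := mem_upperUnitriangular_of_map_eq hγK
  have hγN_eq : (ratGL K γK : GL (Fin (m + 1)) A) = (ω₀ : GL (Fin (m + 1)) A) * C' := by
    have h1 : ((ω₀ : ↥(adelicUnipotent (m + 1) K)) : GL (Fin (m + 1)) A) =
        ((γN : ↥(adelicUnipotent (m + 1) K)) : GL (Fin (m + 1)) A) * C'⁻¹ := rfl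
    rw [h1, inv_mul_cancel_right]
    exact hγK
  -- the corner of `γ_N` is `diag(ν, 1)`
  have hγK0 : γK ∈ tailUnipotent (m + 1) K 0 := by rw [tailUnipotent_zero]; exact hγKu
  set δ : GL (Fin (m + 1)) K := cornerize m (Nat.zero_le m) γK hγK0 with hδ
  have hδc : δ ∈ cornerGL (m + 1) K m := cornerize_mem_cornerGL m (Nat.zero_le m) γK hγK0
  have hδu : δ ∈ upperUnitriangular (Fin (m + 1)) K := by
    have h := cornerize_mem_tailUnipotent m (Nat.zero_le m) γK hγK0
    rwa [tailUnipotent_zero] at h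
  obtain ⟨ν, hν, hνδ⟩ := exists_glCorner_eq_of_mem_cornerGL_of_mem_upperUnitriangular hδc hδu
  -- `corner(γ_N) = corner(ω₀) C'`
  have hω₀0 : ((ω₀ : ↥(adelicUnipotent (m + 1) K)) : GL (Fin (m + 1)) A) ∈ tailUnipotent (m + 1) A 0 :=
    mem_tailUnipotent_zero_of_mem ω₀.2
  have hprod : ((ω₀ : ↥(adelicUnipotent (m + 1) K)) : GL (Fin (m + 1)) A) * C' ∈ tailUnipotent (m + 1) A m :=
    (tailUnipotent (m + 1) A m).mul_mem (tailUnipotent_mono (Nat.zero_le m) hω₀0)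
      (cornerGL_le_tailUnipotent m hC'c)
  have hratδ : ratGL K δ = cornerize m (Nat.zero_le m) ((ω₀ : ↥(adelicUnipotent (m + 1) K)) : GL (Fin (m + 1)) A) hω₀0 * C' := by
    have h1 : ratGL K δ = cornerize m (Nat.zero_le m) (ratGL K γK) (map_mem_tailUnipotent' _ hγK0) :=
      map_cornerize _ m (Nat.zero_le m) γK hγK0 _
    have h2 : cornerize m (Nat.zero_le m) (ratGL K γK) (map_mem_tailUnipotent' _ hγK0) =
        cornerize m le_rfl (((ω₀ : ↥(adelicUnipotent (m + 1) K)) : GL (Fin (m + 1)) A) * C') hprod :=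
      Units.ext (by rw [coe_cornerize, coe_cornerize, hγN_eq])
    rw [h1, h2, cornerize_mul_eq_of_mem_cornerGL (Nat.zero_le m) hω₀0 hC'c hprod]
  -- the matrix identity `diag((ν γ₀)_𝔸, 1) = corner(ω₀) · corner(u⁻¹ diag(γ₀,1))`
  have hP : u⁻¹ * γt ∈ tailUnipotent (m + 1) A m :=
    (tailUnipotent (m + 1) A m).mul_mem (tailUnipotent_mono (Nat.zero_le m) hu'0) (cornerGL_le_tailUnipotent m hγt_corner)
  have hC : cornerize m le_rfl (u⁻¹ * γt) hP = C' * γt := cornerize_mul_eq_of_mem_cornerGL (Nat.zero_le m) hu'0 hγt_corner hP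
  have hmain : glCorner A (Nat.le_succ m) (ratGL K (ν * γ₀)) =
      cornerize m (Nat.zero_le m) ((ω₀ : ↥(adelicUnipotent (m + 1) K)) : GL (Fin (m + 1)) A) hω₀0 *
        cornerize m le_rfl (u⁻¹ * γt) hP := by
    have e1 : ratGL K (ν * γ₀) = ratGL K ν * ratGL K γ₀ := map_mul _ _ _
    have e2 : glCorner A (Nat.le_succ m) (ratGL K ν * ratGL K γ₀) =
        glCorner A (Nat.le_succ m) (ratGL K ν) * glCorner A (Nat.le_succ m) (ratGL K γ₀) := map_mul _ _ _
    rw [e1, e2, ← ratGL_glCorner, hνδ, hratδ, hC, mul_assoc]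
  refine ⟨ν, fun i l => ((((ω₀ : ↥(adelicUnipotent (m + 1) K)) : GL (Fin (m + 1)) A) :
      Matrix (Fin (m + 1)) (Fin (m + 1)) A) i l), hν, fun i l => ?_, fun i j hi => ?_⟩
  · -- entries of `ω₀` lie in Tate's box, or are `1` (diagonal), or `0 ∈ D` (below the diagonal)
    rcases lt_trichotomy i l with hil | rfl | hli
    · exact Or.inl ((mem_unipotentTateDomain_iff.1 hω₀T) i l hil)
    · right
      exact ((mem_upperUnitriangular_iff _).1 ω₀.2).2 i
    · left
      beta_reduce
      rw [((mem_upperUnitriangular_iff _).1 ω₀.2).1 hli]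
      exact zero_mem_adeleFundamentalDomain K
  · rw [hmain, Units.val_mul, Matrix.mul_apply]
    refine Finset.sum_congr rfl fun l _ => ?_
    by_cases hl : (l : ℕ) < m
    · rw [if_pos hl, cornerize_apply_of_lt m (Nat.zero_le m) _ hω₀0 hi, if_pos hl,
        cornerize_apply_of_lt m le_rfl _ hP hl]
    · rw [if_neg hl, cornerize_apply_of_lt m (Nat.zero_le m) _ hω₀0 hi, if_neg hl, zero_mul]

end Reduction

end Literature.NumberTheory.Automorphic
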